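import Mathlib.GroupTheory.Commutator.Basic
import Mathlib.Topology.Algebra.ContinuousMonoidHom
import Literature.GroupTheory.SpecificGroups.PadicAffineGroup

/-!
# The congruence subgroups of `Aff(ℤ_p)` are characteristic (`p` odd)

For the `p`-adic affine group `A = Aff(ℤ_p) = ℤ_p ⋊ ℤ_pˣ` of
`Literature/GroupTheory/SpecificGroups/PadicAffineGroup.lean` and `p ≠ 2` we prove, by elementary
commutator algebra and WITHOUT introducing definitions:

* `PadicAffine.commutatorElement_u/_a` — `⁅(a,u),(b,w)⁆ = ((1 − w)·a + (u − 1)·b, 1)`;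
* `PadicAffine.mem_commutator_top_iff` — for `p ≠ 2` the commutator subgroup `⁅A, A⁆` is EXACTLY the
  translation subgroup `{u = 1}` (every translation `(b,1)` is the single commutator `⁅(0,2),(b,1)⁆`,
  `2 ∈ ℤ_pˣ`);
* `PadicAffine.mem_level_iff_forall_commutator` — the congruence subgroup `Γ_n = level p n` is
  `{x | ∀ y, ⁅x, y⁆ ∈ {t ^ pⁿ | t ∈ ⁅A, A⁆}}`, i.e. the preimage of the centre of `A / pⁿ·⁅A,A⁆`,
  a description invariant under every abstract group automorphism;
* `PadicAffine.map_level_eq_of_mulEquiv` — hence `φ(Γ_n) = Γ_n` for EVERY group automorphism `φ` of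
  `Aff(ℤ_p)` (`p ≠ 2`), and `PadicAffine.map_level_eq_of_continuousMulEquiv`, the same for
  topological-group automorphisms — literally the shape of the field `SpecialFibreTower.N_char` of
  `Literature/AnabelianGeometry/SemiGraphs/TemperedSpecialFibreTower.lean` at `N := level p`
  ([SemiAnbd] Example 3.10: "an exhaustive sequence of open characteristic subgroups of finite index").

Honest remark: for `p = 2` the congruence subgroups `Γ_n`, `n ≥ 1`, are NOT characteristic — the
crossed homomorphism `c : ℤ_2ˣ → ℤ_2`, `c(u) = (1 − u)/2` (integral since `1 − u ∈ 2ℤ_2`, not of the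
form `(1 − u)·t` with `t ∈ ℤ_2`) gives the outer automorphism `(a,u) ↦ (a + (1 − u)/2, u)` of `Aff(ℤ_2)`
(= conjugation by `(1/2, 1)` inside `Aff(ℚ_2)`), which sends `(0, 1 + 2ⁿ) ∈ Γ_n` to
`(−2ⁿ⁻¹, 1 + 2ⁿ) ∉ Γ_n` (`H¹(ℤ_2ˣ, ℤ_2) ≅ ℤ/2 ≠ 0`) — which is why every statement below carries
`p ≠ 2`.  (An informal remark; nothing about `p = 2` is asserted in the kernel.)  Classical group theory; abc-iut cell brick for the NV-L3/SpecialFibreTower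
row (consumer: the tower at `Δ := Aff(ℤ_p)`).  Nothing here concerns [IUTchIII] Cor. 3.12.
-/

noncomputable section

namespace Literature.GroupTheory.SpecificGroups

namespace PadicAffine

open scoped Pointwise commutatorElement

variable {p : ℕ} [Fact p.Prime]

/-! ### Commutators in `Aff(ℤ_p)` -/

/-- The linear part of a commutator is `1`. [cite: MochizukiSemiAnbd2006, §0 p.6] -/
@[simp] theorem commutatorElement_u (x y : PadicAffine p) : (⁅x, y⁆ : PadicAffine p).u = 1 := by
  rw [commutatorElement_def, mul_u, mul_u, mul_u, inv_u, inv_u, mul_comm x.u y.u,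
    mul_inv_cancel_right, mul_inv_cancel]

/-- The translation part of a commutator: `⁅(a,u),(b,w)⁆ = ((1 − w)·a + (u − 1)·b, 1)`.
[cite: MochizukiSemiAnbd2006, §0 p.6] -/
@[simp] theorem commutatorElement_a (x y : PadicAffine p) :
    (⁅x, y⁆ : PadicAffine p).a = (1 - (y.u : ℤ_[p])) * x.a + ((x.u : ℤ_[p]) - 1) * y.a := by
  have hx : (x.u : ℤ_[p]) * ((x.u⁻¹ : ℤ_[p]ˣ) : ℤ_[p]) = 1 := Units.mul_inv x.u
  have hy : (y.u : ℤ_[p]) * ((y.u⁻¹ : ℤ_[p]ˣ) : ℤ_[p]) = 1 := Units.mul_inv y.u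
  simp only [commutatorElement_def, mul_a, mul_u, inv_a, inv_u, Units.val_mul]
  linear_combination (-(y.u : ℤ_[p]) * x.a - y.a) * hx +
    (-((x.u : ℤ_[p]) * ((x.u⁻¹ : ℤ_[p]ˣ) : ℤ_[p])) * y.a) * hy

/-- Powers of a translation: `(d, 1)^k = (k·d, 1)`. [cite: MochizukiSemiAnbd2006, §0 p.6] -/
theorem transl_pow (d : ℤ_[p]) (k : ℕ) :
    (⟨d, 1⟩ : PadicAffine p) ^ k = ⟨(k : ℤ_[p]) * d, 1⟩ := by
  induction k with
  | zero => ext <;> simp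
  | succ k ih =>
    rw [pow_succ, ih]
    ext
    · simp only [mul_a, Units.val_one, one_mul, Nat.cast_succ]; ring
    · simp

/-- Powers of an element with trivial linear part. [cite: MochizukiSemiAnbd2006, §0 p.6] -/
theorem pow_of_u_eq_one (t : PadicAffine p) (ht : t.u = 1) (k : ℕ) :
    t ^ k = ⟨(k : ℤ_[p]) * t.a, 1⟩ := by
  have : t = ⟨t.a, 1⟩ := by ext <;> simp [ht]
  rw [this]
  exact transl_pow t.a k

/-- `2` is a unit of `ℤ_p` for `p ≠ 2`. [folklore] -/
private theorem isUnit_two (hp : p ≠ 2) : IsUnit (2 : ℤ_[p]) := by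
  rw [PadicInt.isUnit_iff]
  have hle : ‖(2 : ℤ_[p])‖ ≤ 1 := PadicInt.norm_le_one _
  have hlt : ¬ ‖(2 : ℤ_[p])‖ < 1 := by
    have e : ((2 : ℤ) : ℤ_[p]) = 2 := by norm_num
    rw [← e, PadicInt.norm_int_lt_one_iff_dvd]
    intro h
    have h2 : (p : ℤ) ≤ 2 := Int.le_of_dvd (by norm_num) h
    have hp2 : 2 ≤ p := (Fact.out : p.Prime).two_le
    omega
  exact le_antisymm hle (not_lt.mp hlt)

/-- The homothety `(0, 2)` (`p ≠ 2`). [folklore] -/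
private theorem homothTwo_u (hp : p ≠ 2) : (((isUnit_two hp).unit : ℤ_[p]ˣ) : ℤ_[p]) = 2 :=
  IsUnit.unit_spec _

/-- Every translation is a commutator: `⁅(0,2),(b,1)⁆ = (b,1)` (`p ≠ 2`).
[folklore] -/
private theorem commutatorElement_homothTwo_transl (hp : p ≠ 2) (b : ℤ_[p]) :
    (⁅(⟨0, (isUnit_two hp).unit⟩ : PadicAffine p), (⟨b, 1⟩ : PadicAffine p)⁆ : PadicAffine p) =
      ⟨b, 1⟩ := by
  ext
  · rw [commutatorElement_a, homothTwo_u hp]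
    simp only [Units.val_one, sub_self, mul_zero, zero_add]
    ring
  · rw [commutatorElement_u]

/-- **The commutator subgroup of `Aff(ℤ_p)` is the translation subgroup** (`p ≠ 2`):
`x ∈ ⁅A, A⁆ ↔ x.u = 1`. [cite: MochizukiSemiAnbd2006, §0 p.6] -/
theorem mem_commutator_top_iff (hp : p ≠ 2) (x : PadicAffine p) :
    x ∈ ⁅(⊤ : Subgroup (PadicAffine p)), (⊤ : Subgroup (PadicAffine p))⁆ ↔ (x.u : ℤ_[p]) = 1 := by
  constructor
  · intro hx
    -- the linear part is a homomorphism to a commutative group, trivial on commutators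
    let uHom : PadicAffine p →* ℤ_[p]ˣ := ⟨⟨fun z => z.u, one_u⟩, mul_u⟩
    have hle : ⁅(⊤ : Subgroup (PadicAffine p)), (⊤ : Subgroup (PadicAffine p))⁆ ≤ uHom.ker := by
      rw [Subgroup.commutator_le]
      intro g₁ _ g₂ _
      rw [MonoidHom.mem_ker, map_commutatorElement, commutatorElement_eq_one_iff_commute]
      exact Commute.all _ _
    have := hle hx
    rw [MonoidHom.mem_ker] at this
    have hu : x.u = 1 := this
    rw [hu, Units.val_one]
  · intro hx
    have hx' : x = ⟨x.a, 1⟩ := by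
      ext
      · rfl
      · rw [hx, Units.val_one]
    rw [hx', ← commutatorElement_homothTwo_transl hp x.a]
    exact Subgroup.commutator_mem_commutator (Subgroup.mem_top _) (Subgroup.mem_top _)

/-! ### The congruence subgroups are characteristic (`p ≠ 2`) -/

/-- **Group-theoretic description of `Γ_n`** (`p ≠ 2`): `x ∈ Γ_n` iff every commutator `⁅x, y⁆` is a
`pⁿ`-th power of an element of `⁅A, A⁆` — i.e. `Γ_n` is the preimage of the centre of
`A / pⁿ·⁅A, A⁆`. [cite: MochizukiSemiAnbd2006, §0 p.6] -/
theorem mem_level_iff_forall_commutator (hp : p ≠ 2) (n : ℕ) (x : PadicAffine p) :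
    x ∈ level p n ↔ ∀ y : PadicAffine p,
      ∃ t ∈ ⁅(⊤ : Subgroup (PadicAffine p)), (⊤ : Subgroup (PadicAffine p))⁆,
        (⁅x, y⁆ : PadicAffine p) = t ^ (p ^ n) := by
  constructor
  · rintro ⟨ha, hu⟩ y
    -- the translation part of `⁅x, y⁆` lies in `pⁿ ℤ_p`
    have hc : (1 - (y.u : ℤ_[p])) * x.a + ((x.u : ℤ_[p]) - 1) * y.a ∈ I p n :=
      (I p n).add_mem ((I p n).mul_mem_left _ ha) ((I p n).mul_mem_right _ hu)
    obtain ⟨d, hd⟩ := Ideal.mem_span_singleton'.mp hc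
    refine ⟨⟨d, 1⟩, (mem_commutator_top_iff hp _).mpr (by simp), ?_⟩
    rw [transl_pow]
    ext
    · rw [commutatorElement_a, ← hd]; push_cast; ring
    · rw [commutatorElement_u]
  · intro h
    refine ⟨?_, ?_⟩
    · -- test against the homothety `(0, 2)`: `⁅x, (0,2)⁆ = (-x.a, 1)`
      obtain ⟨t, ht, hxt⟩ := h ⟨0, (isUnit_two hp).unit⟩
      have htu : t.u = 1 := Units.ext (by simpa using (mem_commutator_top_iff hp t).mp ht)
      rw [pow_of_u_eq_one t htu] at hxt
      have hxa := congrArg PadicAffine.a hxt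
      rw [commutatorElement_a, homothTwo_u hp] at hxa
      simp only [mul_zero, add_zero] at hxa
      -- hxa : (1 - 2) * x.a = ↑(p ^ n) * t.a
      have e : x.a = -((p : ℤ_[p]) ^ n * t.a) := by
        have : (1 - 2 : ℤ_[p]) * x.a = -x.a := by ring
        rw [this] at hxa
        rw [← neg_neg x.a, hxa]; push_cast; ring
      rw [e]
      exact (I p n).neg_mem (Ideal.mul_mem_right _ _ (Ideal.mem_span_singleton_self _))
    · -- test against the translation `(1, 1)`: `⁅x, (1,1)⁆ = (x.u - 1, 1)`
      obtain ⟨t, ht, hxt⟩ := h ⟨1, 1⟩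
      have htu : t.u = 1 := Units.ext (by simpa using (mem_commutator_top_iff hp t).mp ht)
      rw [pow_of_u_eq_one t htu] at hxt
      have hxa := congrArg PadicAffine.a hxt
      rw [commutatorElement_a] at hxa
      simp only [Units.val_one, sub_self, zero_mul, zero_add, mul_one] at hxa
      rw [hxa]; push_cast
      exact Ideal.mul_mem_right _ _ (Ideal.mem_span_singleton_self _)

/-- A group automorphism maps `Γ_n` into `Γ_n` (`p ≠ 2`). [cite: MochizukiSemiAnbd2006, Ex 3.10 p.44] -/
theorem map_level_le_of_mulEquiv (hp : p ≠ 2) (φ : PadicAffine p ≃* PadicAffine p) (n : ℕ) :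
    (level p n).map φ.toMonoidHom ≤ level p n := by
  rintro _ ⟨x, hx, rfl⟩
  rw [SetLike.mem_coe, mem_level_iff_forall_commutator hp] at hx
  rw [MulEquiv.coe_toMonoidHom, mem_level_iff_forall_commutator hp]
  intro y
  obtain ⟨t, ht, hxt⟩ := hx (φ.symm y)
  refine ⟨φ t, ?_, ?_⟩
  · have hmap : (⁅(⊤ : Subgroup (PadicAffine p)), (⊤ : Subgroup (PadicAffine p))⁆).map φ.toMonoidHom =
        ⁅(⊤ : Subgroup (PadicAffine p)), ⊤⁆ := by
      rw [Subgroup.map_commutator, Subgroup.map_top_of_surjective _ φ.surjective]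
    rw [← hmap]
    exact ⟨t, ht, rfl⟩
  · rw [← map_pow, ← hxt, map_commutatorElement, MulEquiv.apply_symm_apply]

/-- **`Γ_n` is characteristic** (`p ≠ 2`): `φ(Γ_n) = Γ_n` for every group automorphism `φ` of
`Aff(ℤ_p)`. [cite: MochizukiSemiAnbd2006, Ex 3.10 p.44] -/
theorem map_level_eq_of_mulEquiv (hp : p ≠ 2) (φ : PadicAffine p ≃* PadicAffine p) (n : ℕ) :
    (level p n).map φ.toMonoidHom = level p n := by
  refine le_antisymm (map_level_le_of_mulEquiv hp φ n) fun x hx => ?_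
  have h := map_level_le_of_mulEquiv hp φ.symm n ⟨x, hx, rfl⟩
  exact ⟨φ.symm x, h, φ.apply_symm_apply x⟩

/-- **`Γ_n` is characteristic for topological-group automorphisms** (`p ≠ 2`) — the shape of the
field `SpecialFibreTower.N_char` at `N := level p`. [cite: MochizukiSemiAnbd2006, Ex 3.10 p.44] -/
theorem map_level_eq_of_continuousMulEquiv (hp : p ≠ 2) (φ : PadicAffine p ≃ₜ* PadicAffine p)
    (n : ℕ) : (level p n).map φ.toMulEquiv.toMonoidHom = level p n :=
  map_level_eq_of_mulEquiv hp φ.toMulEquiv n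

/-- Characteristic for all levels at once, in the `∀ i φ` binder order of `SpecialFibreTower.N_char`.
[cite: MochizukiSemiAnbd2006, Ex 3.10 p.44] -/
theorem level_char (hp : p ≠ 2) :
    ∀ (i : ℕ) (φ : PadicAffine p ≃ₜ* PadicAffine p), (level p i).map φ.toMulEquiv.toMonoidHom = level p i :=
  fun i φ => map_level_eq_of_continuousMulEquiv hp φ i

end PadicAffine

end Literature.GroupTheory.SpecificGroups

end
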